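import Summits.AnomalousDissipation.AnomalousDissipation.Theorems.SolenoidalFractalHomogenisationLagrangianStepVmodPairSplit
import HarnessLib

/-!
# K1L_D (stmt-AnomalousDissipation-27980): (V_mod) flat stage, block (ss) — THE ITERATION ON THE PERIOD GRID (tool T-I of the certifier's table
# `Cruxes/LagrangianRenormalisationStep/Lines/onelevel-ss-regimes.md`, row «C / coarse / y ≥ 1»), abstract propagator-level form
(helper; `--supports 27980 --as helper`; prover ad-sawtooth-k1loc-p1 g15.)

Two families of linear window maps `U, T` on `V2` with the cocycle property (the cell propagator and the coarse propagator), a grid `s_j = s₀ + j·t₁`,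
a slow label `ℓ ≠ 0`, an abstract «class» predicate `CP` preserved by both families (class-pair support), and FIVE one-step tools with constants
`θ, cV, cL, cS, κ ≥ 0`, all hypotheses of this file and all DISCHARGED elsewhere in the lane:
* (V) un-squared on pair data over one grid window: `‖𝓕((U−T)(s_j,t)a)(ℓ)‖ ≤ cV·‖𝓕a(ℓ)‖` (`…VmodPairV`);
* slow leakage of a fast class datum: `‖𝓕(U(s_j,t)f)(ℓ)‖ ≤ cL·‖f‖` (`…VmodLeakSlow`);
* fast content after one grid step: `√(fast(U_j y)) ≤ cS·‖y‖ + κ·√(fast y)` (`…VmodLeakEnergy`);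
* coarse decay at the grid step `‖𝓕(T_j y)(ℓ)‖ ≤ θ‖𝓕y(ℓ)‖` and contraction `‖𝓕(T(s,t)y)(ℓ)‖ ≤ ‖𝓕y(ℓ)‖` (`…VmodCoarseDecay`).
At every restart the state `z_j = U(s₀,s_j)v` is split into its pair `a` and its fast part `f` (`exists_pair_split`); linearity and the cocycle give
the recursion `α_{j+1} ≤ (θ+cV)α_j + cL·φ_j`, `φ_{j+1} ≤ √2·cS·α_j + (cS+κ)φ_j`, `δ_{j+1} ≤ cV·α_j + cL·φ_j + θ·δ_j` for the slow amplitude `α_j`,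
the fast content `φ_j` and the slow defect `δ_j = ‖𝓕(z_j)(ℓ) − 𝓕(T(s₀,s_j)v)(ℓ)‖`, and inside the window `[s_j, s_{j+1}]`:

  `‖𝓕((U−T)(s₀,t)v)(ℓ)‖ ≤ cV·A j + cL·F j + D j`   (`iterate_defect_le`)

for ANY majorising sequences `A, F, D` of the recursion (`F, D ≥ 0`, `A 0 ≥ ‖𝓕v(ℓ)‖`).  The geometric bounds on `A, F, D` and the constants of
the table are the business of the assembly.  `sorry`-free; NOT a proof of (ss), of the stub, of K1L_D or of AD; rung F-D1.A0.
-/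

set_option linter.dupNamespace false

noncomputable section

namespace Summit.AnomalousDissipation.AnomalousDissipation.Theorems.SolenoidalFractalHomogenisation.LagrangianStep.VmodGen

open Set MeasureTheory Complex UnitAddTorus
open scoped InnerProductSpace ENNReal
open Literature.Analysis Literature.Analysis.FunctionSpaces Literature.Analysis.FunctionSpaces.Torus
open Literature.Analysis.FluidPDE Literature.Analysis.FluidPDE.Torus
open Summit.AnomalousDissipation.AnomalousDissipation.Theorems.SolenoidalFractalHomogenisation.LagrangianStep.VmodFlat (fc fc_sub)

/-- `𝓕(y + y′)(k) = 𝓕y(k) + 𝓕y′(k)` on `V2`. -/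
theorem fc_add (y y' : V2) (k : Fin 3 → ℤ) : fc (y + y') k = fc y k + fc y' k := fcoeff_add y y' k

/-- `‖z‖ ≤ √2·‖𝓕z(ℓ)‖ + √(‖z‖² − (‖𝓕z(ℓ)‖² + ‖𝓕z(−ℓ)‖²))` for a real `V2` state and `ℓ ≠ 0` (conjugate symmetry of the pair, Bessel,
`√(a+b) ≤ √a + √b`). -/
theorem norm_le_sqrt_two_mul_add_sqrt {ℓ : Fin 3 → ℤ} (hℓ : ℓ ≠ 0) (z : V2) :
    ‖z‖ ≤ Real.sqrt 2 * ‖fc z ℓ‖ + Real.sqrt (‖z‖ ^ 2 - (‖fc z ℓ‖ ^ 2 + ‖fc z (-ℓ)‖ ^ 2)) := by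
  have hne : ℓ ≠ -ℓ := fun h' => hℓ (by
    funext i; have hi := congrFun h' i; simp only [Pi.neg_apply] at hi; have : ℓ i = 0 := by omega
    simpa using this)
  have hsymm : fc z (-ℓ) = EuclideanSpace.conjVec (fc z ℓ) := isConjSymm_mFourierCoeff (integrable_coe_V2 z) ℓ
  have hpair : ‖fc z ℓ‖ ^ 2 + ‖fc z (-ℓ)‖ ^ 2 = 2 * ‖fc z ℓ‖ ^ 2 := by rw [hsymm, EuclideanSpace.norm_conjVec]; ring
  have hbessel : 2 * ‖fc z ℓ‖ ^ 2 ≤ ‖z‖ ^ 2 := by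
    have h := sum_le_hasSum {ℓ, -ℓ} (fun k _ => sq_nonneg ‖fc z k‖) (hasSum_norm_sq_fcoeff z)
    rw [Finset.sum_pair hne, hpair] at h
    exact h
  have h0 : 0 ≤ ‖z‖ ^ 2 - 2 * ‖fc z ℓ‖ ^ 2 := by linarith
  have e : ‖z‖ = Real.sqrt ((Real.sqrt 2 * ‖fc z ℓ‖) ^ 2 + (‖z‖ ^ 2 - 2 * ‖fc z ℓ‖ ^ 2)) := by
    rw [mul_pow, Real.sq_sqrt (by norm_num : (0:ℝ) ≤ 2)]
    rw [show 2 * ‖fc z ℓ‖ ^ 2 + (‖z‖ ^ 2 - 2 * ‖fc z ℓ‖ ^ 2) = ‖z‖ ^ 2 by ring, Real.sqrt_sq (norm_nonneg _)]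
  rw [hpair]
  calc ‖z‖ = Real.sqrt ((Real.sqrt 2 * ‖fc z ℓ‖) ^ 2 + (‖z‖ ^ 2 - 2 * ‖fc z ℓ‖ ^ 2)) := e
    _ ≤ Real.sqrt ((Real.sqrt 2 * ‖fc z ℓ‖) ^ 2) + Real.sqrt (‖z‖ ^ 2 - 2 * ‖fc z ℓ‖ ^ 2) := by
        rw [← Real.sqrt_sq (add_nonneg (Real.sqrt_nonneg ((Real.sqrt 2 * ‖fc z ℓ‖) ^ 2)) (Real.sqrt_nonneg _))]
        apply Real.sqrt_le_sqrt
        nlinarith [Real.sq_sqrt (sq_nonneg (Real.sqrt 2 * ‖fc z ℓ‖)), Real.sq_sqrt h0,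
          Real.sqrt_nonneg ((Real.sqrt 2 * ‖fc z ℓ‖) ^ 2), Real.sqrt_nonneg (‖z‖ ^ 2 - 2 * ‖fc z ℓ‖ ^ 2)]
    _ = Real.sqrt 2 * ‖fc z ℓ‖ + Real.sqrt (‖z‖ ^ 2 - 2 * ‖fc z ℓ‖ ^ 2) := by
        rw [Real.sqrt_sq (by positivity)]

section Iterate

variable {U T : ℝ → ℝ → (V2 →L[ℝ] V2)} {Tw s₀ t₁ : ℝ} {ℓ : Fin 3 → ℤ} {CP : V2 → Prop} {θ cV cL cS κ : ℝ}

set_option maxHeartbeats 1600000 in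
/-- **THE GRID ITERATION (abstract propagator level).**  See the module docstring for the meaning of the hypotheses. -/
theorem iterate_defect_le (hℓ : ℓ ≠ 0) (hs₀ : 0 ≤ s₀) (ht₁ : 0 < t₁)
    (hUcomp : ∀ s t r, 0 ≤ s → s ≤ t → t ≤ r → r ≤ Tw → ∀ y : V2, U t r (U s t y) = U s r y)
    (hTcomp : ∀ s t r, 0 ≤ s → s ≤ t → t ≤ r → r ≤ Tw → ∀ y : V2, T t r (T s t y) = T s r y)
    (hUdf : ∀ s t (y : V2), U s t y ∈ divFreeL2 (Fin 3)) (hTdf : ∀ s t (y : V2), T s t y ∈ divFreeL2 (Fin 3))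
    (hUcl : ∀ s t, 0 ≤ s → s ≤ t → t ≤ Tw → ∀ y : V2, y ∈ divFreeL2 (Fin 3) → CP y → CP (U s t y))
    (hCPpair : ∀ a : V2, (∀ k, k ≠ ℓ → k ≠ -ℓ → fc a k = 0) → CP a)
    (hCPoff : ∀ y f : V2, CP y → (∀ k, k ≠ ℓ → k ≠ -ℓ → fc f k = fc y k) → fc f ℓ = 0 → fc f (-ℓ) = 0 → CP f)
    (hθ : 0 ≤ θ) (hcV : 0 ≤ cV) (hcL : 0 ≤ cL) (hcS : 0 ≤ cS) (hκ : 0 ≤ κ)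
    (hV1 : ∀ j : ℕ, ∀ t, s₀ + j * t₁ ≤ t → t ≤ s₀ + (j + 1) * t₁ → t ≤ Tw → ∀ a : V2, a ∈ divFreeL2 (Fin 3) →
      (∀ k, k ≠ ℓ → k ≠ -ℓ → fc a k = 0) → ‖fc (U (s₀ + j * t₁) t a - T (s₀ + j * t₁) t a) ℓ‖ ≤ cV * ‖fc a ℓ‖)
    (hLk : ∀ j : ℕ, ∀ t, s₀ + j * t₁ ≤ t → t ≤ s₀ + (j + 1) * t₁ → t ≤ Tw → ∀ f : V2, f ∈ divFreeL2 (Fin 3) → CP f →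
      fc f ℓ = 0 → fc f (-ℓ) = 0 → ‖fc (U (s₀ + j * t₁) t f) ℓ‖ ≤ cL * ‖f‖)
    (hFs : ∀ j : ℕ, s₀ + (j + 1) * t₁ ≤ Tw → ∀ y : V2, y ∈ divFreeL2 (Fin 3) → CP y →
      Real.sqrt (‖U (s₀ + j * t₁) (s₀ + (j + 1) * t₁) y‖ ^ 2 -
          (‖fc (U (s₀ + j * t₁) (s₀ + (j + 1) * t₁) y) ℓ‖ ^ 2 + ‖fc (U (s₀ + j * t₁) (s₀ + (j + 1) * t₁) y) (-ℓ)‖ ^ 2))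
        ≤ cS * ‖y‖ + κ * Real.sqrt (‖y‖ ^ 2 - (‖fc y ℓ‖ ^ 2 + ‖fc y (-ℓ)‖ ^ 2)))
    (hTθ : ∀ j : ℕ, s₀ + (j + 1) * t₁ ≤ Tw → ∀ y : V2, y ∈ divFreeL2 (Fin 3) →
      ‖fc (T (s₀ + j * t₁) (s₀ + (j + 1) * t₁) y) ℓ‖ ≤ θ * ‖fc y ℓ‖)
    (hT1 : ∀ s t, 0 ≤ s → s ≤ t → t ≤ Tw → ∀ y : V2, y ∈ divFreeL2 (Fin 3) → ‖fc (T s t y) ℓ‖ ≤ ‖fc y ℓ‖)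
    (v : V2) (hvs : ∀ k, k ≠ ℓ → k ≠ -ℓ → fc v k = 0)
    (hU0 : U s₀ s₀ v = v) (hT0 : T s₀ s₀ v = v)
    (A F D : ℕ → ℝ) (hFnn : ∀ j, 0 ≤ F j) (hDnn : ∀ j, 0 ≤ D j) (hA0 : ‖fc v ℓ‖ ≤ A 0)
    (hArec : ∀ j, (θ + cV) * A j + cL * F j ≤ A (j + 1)) (hFrec : ∀ j, Real.sqrt 2 * cS * A j + (cS + κ) * F j ≤ F (j + 1))
    (hDrec : ∀ j, cV * A j + cL * F j + θ * D j ≤ D (j + 1)) :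
    ∀ j : ℕ, ∀ t, s₀ + j * t₁ ≤ t → t ≤ s₀ + (j + 1) * t₁ → t ≤ Tw →
      ‖fc (U s₀ t v - T s₀ t v) ℓ‖ ≤ cV * A j + cL * F j + D j := by
  -- the invariant at the grid point `s_j`
  have inv : ∀ j : ℕ, s₀ + j * t₁ ≤ Tw →
      CP (U s₀ (s₀ + j * t₁) v) ∧
      ‖fc (U s₀ (s₀ + j * t₁) v) ℓ‖ ≤ A j ∧
      Real.sqrt (‖U s₀ (s₀ + j * t₁) v‖ ^ 2 - (‖fc (U s₀ (s₀ + j * t₁) v) ℓ‖ ^ 2 + ‖fc (U s₀ (s₀ + j * t₁) v) (-ℓ)‖ ^ 2)) ≤ F j ∧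
      ‖fc (U s₀ (s₀ + j * t₁) v) ℓ - fc (T s₀ (s₀ + j * t₁) v) ℓ‖ ≤ D j := by
    intro j
    induction j with
    | zero =>
        intro _
        simp only [Nat.cast_zero, zero_mul, add_zero, hU0, hT0]
        refine ⟨hCPpair v hvs, hA0, ?_, by rw [sub_self, norm_zero]; exact hDnn 0⟩
        -- the pair datum has no fast content
        have hne : ℓ ≠ -ℓ := fun h' => hℓ (by
          funext i; have hi := congrFun h' i; simp only [Pi.neg_apply] at hi; have : ℓ i = 0 := by omega
          simpa using this)
        have hpars := hasSum_norm_sq_fcoeff v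
        have hfin : HasSum (fun k => ‖fc v k‖ ^ 2) (∑ k ∈ ({ℓ, -ℓ} : Finset (Fin 3 → ℤ)), ‖fc v k‖ ^ 2) := by
          refine hasSum_sum_of_ne_finset_zero fun k hk => ?_
          rw [Finset.mem_insert, Finset.mem_singleton, not_or] at hk
          rw [hvs k hk.1 hk.2, norm_zero, zero_pow two_ne_zero]
        have e := hpars.unique hfin
        rw [Finset.sum_pair hne] at e
        have : ‖v‖ ^ 2 - (‖fc v ℓ‖ ^ 2 + ‖fc v (-ℓ)‖ ^ 2) = 0 := by rw [← e]; exact sub_self _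
        rw [this, Real.sqrt_zero]; exact hFnn 0
    | succ j ih =>
        intro hj1
        have hcast : ((j + 1 : ℕ) : ℝ) = (j : ℝ) + 1 := by push_cast; ring
        rw [hcast] at hj1 ⊢
        have hj0 : s₀ + j * t₁ ≤ Tw := by nlinarith [ht₁]
        obtain ⟨hCPz, hα, hφ, hδ⟩ := ih hj0
        -- names
        set sj : ℝ := s₀ + j * t₁ with hsj
        set sj1 : ℝ := s₀ + (j + 1) * t₁ with hsj1
        have hsj0 : 0 ≤ sj := by rw [hsj]; positivity
        have hs0j : s₀ ≤ sj := by rw [hsj]; nlinarith [ht₁]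
        have hjj1 : sj ≤ sj1 := by rw [hsj, hsj1]; nlinarith [ht₁]
        set z : V2 := U s₀ sj v with hz
        set w : V2 := T s₀ sj v with hw
        have hzdf : z ∈ divFreeL2 (Fin 3) := hUdf _ _ _
        have hwdf : w ∈ divFreeL2 (Fin 3) := hTdf _ _ _
        -- split the state
        obtain ⟨a, f, hzaf, hadf, hfdf, haoff, haℓ, -, hf1, hf2, hfoff, hna, hnf⟩ := exists_pair_split hℓ z hzdf
        have hCPa : CP a := hCPpair a haoff
        have hCPf : CP f := hCPoff z f hCPz hfoff hf1 hf2
        have hfnorm : ‖f‖ = Real.sqrt (‖z‖ ^ 2 - (‖fc z ℓ‖ ^ 2 + ‖fc z (-ℓ)‖ ^ 2)) := by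
          rw [← hnf, Real.sqrt_sq (norm_nonneg _)]
        have hφ' : ‖f‖ ≤ F j := by rw [hfnorm]; exact hφ
        -- cocycle
        have hz1 : U s₀ sj1 v = U sj sj1 z := by rw [hz, hUcomp s₀ sj sj1 hs₀ hs0j hjj1 hj1]
        have hw1 : T s₀ sj1 v = T sj sj1 w := by rw [hw, hTcomp s₀ sj sj1 hs₀ hs0j hjj1 hj1]
        have hUz : U sj sj1 z = U sj sj1 a + U sj sj1 f := by rw [hzaf, map_add]
        -- the four one-step estimates
        have e1 : ‖fc (U sj sj1 a - T sj sj1 a) ℓ‖ ≤ cV * ‖fc a ℓ‖ := hV1 j sj1 hjj1 le_rfl hj1 a hadf haoff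
        have e2 : ‖fc (U sj sj1 f) ℓ‖ ≤ cL * ‖f‖ := hLk j sj1 hjj1 le_rfl hj1 f hfdf hCPf hf1 hf2
        have e3 : ‖fc (T sj sj1 a) ℓ‖ ≤ θ * ‖fc a ℓ‖ := hTθ j hj1 a hadf
        have e4 : ‖fc (T sj sj1 (a - w)) ℓ‖ ≤ θ * ‖fc (a - w) ℓ‖ := hTθ j hj1 (a - w) ((divFreeL2 (Fin 3)).sub_mem hadf hwdf)
        refine ⟨?_, ?_, ?_, ?_⟩
        · -- class preservation
          rw [hz1]; exact hUcl sj sj1 hsj0 hjj1 hj1 z hzdf hCPz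
        · -- slow amplitude
          rw [hz1, hUz, fc_add]
          have hsplit : fc (U sj sj1 a) ℓ = fc (T sj sj1 a) ℓ + fc (U sj sj1 a - T sj sj1 a) ℓ := by rw [fc_sub]; abel
          calc ‖fc (U sj sj1 a) ℓ + fc (U sj sj1 f) ℓ‖ ≤ ‖fc (U sj sj1 a) ℓ‖ + ‖fc (U sj sj1 f) ℓ‖ := norm_add_le _ _
            _ ≤ (‖fc (T sj sj1 a) ℓ‖ + ‖fc (U sj sj1 a - T sj sj1 a) ℓ‖) + cL * ‖f‖ := by
                rw [hsplit]; exact add_le_add (norm_add_le _ _) e2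
            _ ≤ (θ * ‖fc a ℓ‖ + cV * ‖fc a ℓ‖) + cL * F j := add_le_add (add_le_add e3 e1) (mul_le_mul_of_nonneg_left hφ' hcL)
            _ = (θ + cV) * ‖fc z ℓ‖ + cL * F j := by rw [haℓ]; ring
            _ ≤ (θ + cV) * A j + cL * F j := by nlinarith [mul_le_mul_of_nonneg_left hα (add_nonneg hθ hcV)]
            _ ≤ A (j + 1) := hArec j
        · -- fast content
          rw [hz1]
          have h1 := hFs j hj1 z hzdf hCPz
          have h2 : ‖z‖ ≤ Real.sqrt 2 * ‖fc z ℓ‖ + Real.sqrt (‖z‖ ^ 2 - (‖fc z ℓ‖ ^ 2 + ‖fc z (-ℓ)‖ ^ 2)) :=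
            norm_le_sqrt_two_mul_add_sqrt hℓ z
          calc _ ≤ cS * ‖z‖ + κ * Real.sqrt (‖z‖ ^ 2 - (‖fc z ℓ‖ ^ 2 + ‖fc z (-ℓ)‖ ^ 2)) := h1
            _ ≤ cS * (Real.sqrt 2 * A j + F j) + κ * F j := by
                have h3 : ‖z‖ ≤ Real.sqrt 2 * A j + F j :=
                  h2.trans (add_le_add (mul_le_mul_of_nonneg_left hα (Real.sqrt_nonneg 2)) hφ)
                nlinarith [mul_le_mul_of_nonneg_left h3 hcS, mul_le_mul_of_nonneg_left hφ hκ]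
            _ = Real.sqrt 2 * cS * A j + (cS + κ) * F j := by ring
            _ ≤ F (j + 1) := hFrec j
        · -- slow defect
          rw [hz1, hw1, hUz, fc_add]
          have hsplit : fc (U sj sj1 a) ℓ + fc (U sj sj1 f) ℓ - fc (T sj sj1 w) ℓ =
              fc (U sj sj1 a - T sj sj1 a) ℓ + fc (U sj sj1 f) ℓ + fc (T sj sj1 (a - w)) ℓ := by
            rw [map_sub, fc_sub, fc_sub]; abel
          rw [hsplit]
          have h5 : ‖fc (a - w) ℓ‖ ≤ D j := by rw [fc_sub, haℓ]; exact hδ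
          calc ‖fc (U sj sj1 a - T sj sj1 a) ℓ + fc (U sj sj1 f) ℓ + fc (T sj sj1 (a - w)) ℓ‖
              ≤ ‖fc (U sj sj1 a - T sj sj1 a) ℓ‖ + ‖fc (U sj sj1 f) ℓ‖ + ‖fc (T sj sj1 (a - w)) ℓ‖ := norm_add₃_le
            _ ≤ cV * ‖fc a ℓ‖ + cL * ‖f‖ + θ * ‖fc (a - w) ℓ‖ := add_le_add (add_le_add e1 e2) e4
            _ ≤ cV * A j + cL * F j + θ * D j := by
                rw [haℓ]
                exact add_le_add (add_le_add (mul_le_mul_of_nonneg_left hα hcV) (mul_le_mul_of_nonneg_left hφ' hcL))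
                  (mul_le_mul_of_nonneg_left h5 hθ)
            _ ≤ D (j + 1) := hDrec j
  -- inside the window `[s_j, s_{j+1}]`
  intro j t hjt htj1 htT
  have hj0 : s₀ + j * t₁ ≤ Tw := hjt.trans htT
  obtain ⟨hCPz, hα, hφ, hδ⟩ := inv j hj0
  set sj : ℝ := s₀ + j * t₁ with hsj
  have hsj0 : 0 ≤ sj := by rw [hsj]; positivity
  have hs0j : s₀ ≤ sj := by rw [hsj]; nlinarith [ht₁]
  set z : V2 := U s₀ sj v with hz
  set w : V2 := T s₀ sj v with hw
  have hzdf : z ∈ divFreeL2 (Fin 3) := hUdf _ _ _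
  have hwdf : w ∈ divFreeL2 (Fin 3) := hTdf _ _ _
  obtain ⟨a, f, hzaf, hadf, hfdf, haoff, haℓ, -, hf1, hf2, hfoff, hna, hnf⟩ := exists_pair_split hℓ z hzdf
  have hCPf : CP f := hCPoff z f hCPz hfoff hf1 hf2
  have hfnorm : ‖f‖ = Real.sqrt (‖z‖ ^ 2 - (‖fc z ℓ‖ ^ 2 + ‖fc z (-ℓ)‖ ^ 2)) := by
    rw [← hnf, Real.sqrt_sq (norm_nonneg _)]
  have hφ' : ‖f‖ ≤ F j := by rw [hfnorm]; exact hφ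
  have hzt : U s₀ t v = U sj t z := by rw [hz, hUcomp s₀ sj t hs₀ hs0j hjt htT]
  have hwt : T s₀ t v = T sj t w := by rw [hw, hTcomp s₀ sj t hs₀ hs0j hjt htT]
  have e1 : ‖fc (U sj t a - T sj t a) ℓ‖ ≤ cV * ‖fc a ℓ‖ := hV1 j t hjt htj1 htT a hadf haoff
  have e2 : ‖fc (U sj t f) ℓ‖ ≤ cL * ‖f‖ := hLk j t hjt htj1 htT f hfdf hCPf hf1 hf2
  have e4 : ‖fc (T sj t (a - w)) ℓ‖ ≤ ‖fc (a - w) ℓ‖ := hT1 sj t hsj0 hjt htT (a - w) ((divFreeL2 (Fin 3)).sub_mem hadf hwdf)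
  rw [hzt, hwt, hzaf, map_add]
  have hsplit : fc (U sj t a + U sj t f - T sj t w) ℓ = fc (U sj t a - T sj t a) ℓ + fc (U sj t f) ℓ + fc (T sj t (a - w)) ℓ := by
    rw [map_sub, fc_sub, fc_add, fc_sub, fc_sub]; abel
  rw [hsplit]
  have h5 : ‖fc (a - w) ℓ‖ ≤ D j := by rw [fc_sub, haℓ]; exact hδ
  calc ‖fc (U sj t a - T sj t a) ℓ + fc (U sj t f) ℓ + fc (T sj t (a - w)) ℓ‖
      ≤ ‖fc (U sj t a - T sj t a) ℓ‖ + ‖fc (U sj t f) ℓ‖ + ‖fc (T sj t (a - w)) ℓ‖ := norm_add₃_le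
    _ ≤ cV * ‖fc a ℓ‖ + cL * ‖f‖ + ‖fc (a - w) ℓ‖ := add_le_add (add_le_add e1 e2) e4
    _ ≤ cV * A j + cL * F j + D j := by
        rw [haℓ]
        exact add_le_add (add_le_add (mul_le_mul_of_nonneg_left hα hcV) (mul_le_mul_of_nonneg_left hφ' hcL)) h5

end Iterate

end Summit.AnomalousDissipation.AnomalousDissipation.Theorems.SolenoidalFractalHomogenisation.LagrangianStep.VmodGen

end
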